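import Mathlib
import Summits.Ventures.PercRepro.TriangleCapRowA
import Summits.Ventures.PercRepro.TriangleCapRowBCornerEvery

/-!
# PercRepro — THE CELL r = a FOR EVERY ROW a ≥ 5: the theorems of the source module re-derived WITHOUT the bound through
`below_second_order_every` (part 204b) in place of `below_second_order_all` (p3, gen 49; part 204c)

The proofs are those of the source module verbatim; the bound `a ≤ 18` entered them only through the `B2` regime
`below_second_order_all` of part 200zi (the corner `k = 2a + r`, now `below_corner_every`) and through the earlier
rows. Axioms: standard.
-/

namespace PercRepro

namespace TriangleCap

namespace C047

open Finset

universe u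

variable {V : Type*} [Fintype V] [DecidableEq V]

/-- **THE ROW `r = a`, `5 ≤ a`, `3a ≤ k`:** `K₄⁻`-free, `m + a = a (k − a)` ⇒ `a`-bipartite or
`Σ_v d(v)² + a (k − 1 − a) + 2 (k − a − 3) ≤ m k`. -/
theorem rowA_second_order_gen_every (D : SimpleGraph V) [DecidableRel D.Adj] (hK : K4mFree D) (a : ℕ)
    (ha5 : 5 ≤ a) (hk : 3 * a ≤ Fintype.card V)
    (hm : D.edgeFinset.card + a = a * (Fintype.card V - a)) :
    (∃ A : Finset V, A.card = a ∧ BipSub D A) ∨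
      ∑ v, deg D v * deg D v + a * (Fintype.card V - 1 - a) + 2 * (Fintype.card V - a - 3) ≤
        D.edgeFinset.card * Fintype.card V := by
  have hk2 : 2 * a + 2 ≤ Fintype.card V := by omega
  -- (A) a vertex at the cap
  by_cases hx : ∃ x, deg D x + a = Fintype.card V
  · obtain ⟨x, hx⟩ := hx
    exact cap_A_gen D hK a ha5 hk hm x hx
  push Not at hx
  have hcap : ∀ v, deg D v + a ≤ Fintype.card V := fun v =>
    deg_add_le_card_of_dense D hK a (by omega) (by omega)
      (cap_arith a (Fintype.card V) D.edgeFinset.card a (by omega) (by omega)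
        (below_cap_arith a (Fintype.card V) D.edgeFinset.card a (by omega) hm)) v
  have hcap' : ∀ v, deg D v + a + 1 ≤ Fintype.card V := fun v => by
    have h1 := hcap v
    have h2 := hx v
    omega
  have hcap2 : ∀ v, deg D v ≤ (Fintype.card V - a - 2) + 1 := fun v => by have := hcap' v; omega
  -- (B) every degree `≥ a`: the window
  by_cases hdeg : ∀ v, a ≤ deg D v
  · exact Or.inr (rowA_window D a (by omega) (by omega) hm hcap' hdeg)
  push Not at hdeg
  obtain ⟨z, hz⟩ := hdeg
  -- the deletion bookkeeping: `D − z` on `(k − 1, a, d)`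
  have hK' := k4mFree_del D hK z
  have hcard' := card_del z
  have hedges' := card_edges_del D z
  have hsq := sum_deg_sq_del D z
  have hT := sum_del_nbhd_le D z (Fintype.card V - a - 2) hcap2
  obtain ⟨T, hTdef⟩ : ∃ T, ∑ w : {v : V // v ≠ z}, (if D.Adj w.1 z then deg (del D z) w else 0) = T := ⟨_, rfl⟩
  obtain ⟨S', hS'def⟩ : ∃ S', ∑ w : {v : V // v ≠ z}, deg (del D z) w * deg (del D z) w = S' := ⟨_, rfl⟩
  obtain ⟨m', hm'def⟩ : ∃ m', (del D z).edgeFinset.card = m' := ⟨_, rfl⟩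
  rw [hTdef, hS'def] at hsq
  rw [hTdef] at hT
  rw [hm'def] at hedges'
  have hcardV' : Fintype.card {v : V // v ≠ z} = Fintype.card V - 1 := by omega
  have hm' : (del D z).edgeFinset.card + deg D z = a * (Fintype.card {v : V // v ≠ z} - a) := by
    rw [hm'def, hcardV']
    exact below_cell_edges a a (deg D z) (deg D z) (Fintype.card V) D.edgeFinset.card m' hk2 (by omega) hedges' hm
  have hmd : m' + deg D z + a = a * (Fintype.card V - a) := by omega
  have hside : ∀ A' : Finset {v : V // v ≠ z}, A'.card = a → BipSub (del D z) A' →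
      (∃ A : Finset V, A.card = a ∧ BipSub D A) ∨
        (∑ v, deg D v * deg D v + a * (Fintype.card V - 1 - a) + 2 * (Fintype.card V - a - 3) ≤
          D.edgeFinset.card * Fintype.card V) ∨
        (2 ≤ deg D z ∧ T + (Fintype.card V - a - 2) ≤ deg D z * (Fintype.card V - a - 2) + a) := by
    intro A' hA'card hB
    have := sides_A_gen D a (by omega) hk hm z (by omega) A' hA'card hB hm' hcap2
    rw [hTdef] at this
    exact this
  -- the four kinds of cells
  rcases Nat.eq_zero_or_pos (deg D z) with hd0 | hdpos
  · -- `d = 0`: the diagonal `(k − 1, a, 0)`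
    have hm'0 : (del D z).edgeFinset.card = a * (Fintype.card {v : V // v ≠ z} - a) := by
      have := hm'
      rw [hd0, add_zero] at this
      exact this
    rcases diag_second_order_gen (del D z) hK' a (by omega) (by omega) hm'0 with ⟨A', hA'card, hB⟩ | hgap
    · rcases hside A' hA'card hB with h | h | ⟨h2, _⟩
      · exact Or.inl h
      · exact Or.inr h
      · omega
    · right
      rw [hS'def, hm'def, hcardV'] at hgap
      rw [hd0] at hT hedges' hmd
      rw [hsq, ← hedges', hd0]
      exact rowA_del_zero a (Fintype.card V) m' S' T ha5 hk hmd hgap hT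
  · rcases Nat.lt_or_ge (deg D z + 2) a with hd3 | hd3
    · -- `1 ≤ d ≤ a − 3`: a `B2` cell
      rcases below_second_order_every (del D z) hK' a (deg D z) (by omega) (by omega) (by omega) hm'
        with ⟨A', hA'card, hB⟩ | hgap
      · rcases hside A' hA'card hB with h | h | ⟨h2, hT'⟩
        · exact Or.inl h
        · exact Or.inr h
        · right
          have hS := sum_deg_sq_le_of_bipSub (del D z) A' hB a (deg D z) hA'card hm' (by omega)
          rw [hS'def, hm'def, hcardV'] at hS
          rw [hsq, ← hedges']
          exact rowA_mixed a (deg D z) (Fintype.card V) m' S' T ha5 h2 (by omega) hk hmd hS hT'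
      · right
        rw [hS'def, hm'def, hcardV'] at hgap
        rw [hsq, ← hedges']
        exact rowA_del_B2 a (deg D z) (Fintype.card V) m' S' T ha5 hdpos (by omega) hk hmd hgap hT
    · rcases Nat.lt_or_ge (deg D z + 1) a with hd2 | hd2
      · -- `d = a − 2`: the `T` cell
        have hda : deg D z = a - 2 := by omega
        rw [hda] at hm' hT hedges' hmd
        rcases rowT_second_order_gen_every (del D z) hK' a (a - 2) ha5 (by omega) (by rw [hcardV']; omega) hm'
          with ⟨A', hA'card, hB⟩ | hgap
        · rcases hside A' hA'card hB with h | h | ⟨h2, hT'⟩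
          · exact Or.inl h
          · exact Or.inr h
          · right
            have hS := sum_deg_sq_le_of_bipSub (del D z) A' hB a (a - 2) hA'card hm' (by omega)
            rw [hS'def, hm'def, hcardV'] at hS
            rw [hda] at hT' h2
            rw [hsq, ← hedges', hda]
            exact rowA_mixed a (a - 2) (Fintype.card V) m' S' T ha5 h2 (by omega) hk hmd hS hT'
        · right
          rw [hS'def, hm'def, hcardV'] at hgap
          rw [hsq, ← hedges', hda]
          exact rowA_del_T a (Fintype.card V) m' S' T ha5 hk hmd hgap hT
      · -- `d = a − 1`: the `B2` cell `r′ = a − 1`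
        have hda : deg D z = a - 1 := by omega
        rw [hda] at hm' hT hedges' hmd
        rcases rowB_second_order_all_every (del D z) hK' a (a - 1) ha5 (by omega) (by rw [hcardV']; omega) hm'
          with ⟨A', hA'card, hB⟩ | hgap
        · rcases hside A' hA'card hB with h | h | ⟨h2, hT'⟩
          · exact Or.inl h
          · exact Or.inr h
          · right
            have hS := sum_deg_sq_le_of_bipSub (del D z) A' hB a (a - 1) hA'card hm' (by omega)
            rw [hS'def, hm'def, hcardV'] at hS
            rw [hda] at hT' h2
            rw [hsq, ← hedges', hda]
            exact rowA_mixed a (a - 1) (Fintype.card V) m' S' T ha5 h2 (by omega) hk hmd hS hT'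
        · right
          rw [hS'def, hm'def, hcardV'] at hgap
          rw [hsq, ← hedges', hda]
          exact rowA_del_B a (Fintype.card V) m' S' T ha5 hk hmd hgap hT

end C047

end TriangleCap

end PercRepro
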